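import Summits.Ventures.DiscreteObjects.Hadamard.Order167Normalizer668
import Summits.Ventures.DiscreteObjects.Hadamard.GSRowSums167

/-!
# Hadamard 668 census — signed/permuted affine symmetries of four-circulant Goethals–Seidel quadruples of order 167
# have multiplier `±1` (kernel EXCLUSION of every other symmetry type)

Framing: lottery ticket; floor = certified bounds/negative ranges.

Cell pub-namedobj (venture DiscreteObjects), target (H), hadamard gen 26.  The common first equation of EVERY four-circulant
family at order `668 = 4·167` (Williamson, Williamson-type with circulant blocks, Ito-type, good / best / G-matrices, propus with
circulant blocks, Goethals–Seidel proper) is a Goethals–Seidel quadruple over `ZMod 167`: four `±1` rows `a_k` with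
`Σ_k PAF_{a_k}(s) = 0` for `s ≠ 0` (`GSQuad`, `GSRowSums167`).  The natural symmetry group of this system is
`(ZMod 167)⁴ ⋊ (ZMod 167)ˣ × (signed S₄)`: independent translations of the four rows, a COMMON multiplier, permutations and
sign changes of the rows.  A symmetry of a quadruple is a relation
  `a_{π k}(h x + c_k) = ε_k a_k(x)`   for all `k, x`   (`π ∈ S₄`, `ε_k = ±1`, `c_k ∈ ZMod 167`, `h ∈ ZMod 167`).
Gen 2/4 excluded row-wise invariance under the squares (`no_gs_quad_qr167`: 0 of 4096 quadruples), gen 20 showed on the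
automorphism side that whatever normalises an automorphism of order 167 of a putative H(668) acts on it as `±1`
(`hadamard668_order167_normalizer_sq_eq_one_general`).  This file is the SEQUENCE-side census, with row permutations, signs
and independent translations allowed, and with no automorphism hypothesis:
* `affineSymmetry_iterate`, `blockAffineInvariant_of_affineSymmetry` — iterating the relation `24 = |S₄|` steps twice makes
  every row invariant under its own affine map `x ↦ h⁴⁸ x + D_k` (any modulus `n`);
* `gsQuad167_sum_rowsum_sq`, `gsQuad167_not_constant`, `gsQuad167_no_translationInvariant_row` — no row of a GS quadruple over
  `ZMod 167` is constant, hence none is invariant under a non-zero translation (`(Σ a_k)² = 167² > 668`);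
* **`gsQuad167_affineSymmetry_sq_eq_one`** (EXCLUSION) — if `a_{π k}(h x + c_k) = ε_k a_k(x)` for all `k, x` then **`h² = 1`**:
  `h = 0` would make the rows constant; for `h ≠ 0`, `h² ≠ 1` the element `h⁴⁸` satisfies `(h⁴⁸)² ≠ 1` (`gcd(96,166) = 2`), each
  row has an `h⁴⁸`-invariant translate (fixed point of the affine map, `exists_translate_hInvariant_prime`), translating the rows
  independently preserves `GSQuad` (`PAF_translate`), an `h⁴⁸`-invariant row is square-invariant (`inv4_of_hInvariant`), and
  square-invariant quadruples do not exist (`no_gs_quad_qr167`);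
* `gsQuad167_no_affineSymmetry` — the same as a negative line for `h² ≠ 1` (covers `h = 0` and all `h` of order `83`, `166`);
* `gsQuad167_no_commonTranslation` — a COMMON translation `x ↦ x + c`, `c ≠ 0` (with any `π`, signs) is impossible as well
  (`48 c ≠ 0` would be a period of every row);
* `gsQuad167_reflection_recentre` — for `h = -1` with a common shift, `a_{π k}(c - x) = ε_k a_k(x)` is conjugate by the
  translation `x ↦ x + 84 c` (`2·84 ≡ 1`) to a signed/permuted REVERSAL symmetry `a'_{π k}(-x) = ε_k a'_k(x)` — the shape of
  Williamson (`π = 1`, `ε = 1`) and Williamson-like quadruples, which remain OPEN.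
So for every four-circulant search at order 668 the only symmetry assumptions from `AGL(1,167) × (signed S₄)` that are not
already refuted are reflections/reversals (`h = -1`) and pure row-wise translation patterns with `h = 1` whose net periods
vanish.  EXCLUSION of symmetry types of a hypothetical object; no Hadamard order excluded; H(668) untouched; HITS 0/4.  Ours,
elementary given the cited tree lemmas; no `sorry`, `decide` only for `(48 : ZMod 167) ≠ 0` / `(2 : ZMod 167) * 84 = 1`.
-/

open Finset BigOperators

namespace Summit.Ventures.DiscreteObjects.Hadamard

open Literature.Combinatorics.Designs.LegendrePairs (PAF IsPM PAF_translate TwistedInvariant HInvariant)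

-- the tree's cyclic translate `i ↦ x (i + μ)` is used under an alias (Mathlib also has a `_root_.translate`)
open Literature.Combinatorics.Designs.LegendrePairs renaming translate → cycTranslate

/-! ## §1 Iterating a signed/permuted affine symmetry with row-wise translations (any modulus) -/

section Iterate

variable {n : ℕ} {a : Fin 4 → ZMod n → ℤ} {h : ZMod n} {c : Fin 4 → ZMod n} {π : Equiv.Perm (Fin 4)} {ε : Fin 4 → ℤ}

/-- iterating `a (π k) (h x + c_k) = ε_k a_k(x)`: after `m` steps `a (πᵐ k) (hᵐ x + C_m(k)) = E_m(k) a_k(x)` with signs `E_m`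
and row-wise shifts `C_m`. -/
lemma affineSymmetry_iterate (hε : ∀ k, ε k = 1 ∨ ε k = -1)
    (hrel : ∀ k x, a (π k) (h * x + c k) = ε k * a k x) :
    ∀ m : ℕ, ∃ (E : Fin 4 → ℤ) (C : Fin 4 → ZMod n),
      (∀ k, E k = 1 ∨ E k = -1) ∧ ∀ k x, a ((π ^ m) k) (h ^ m * x + C k) = E k * a k x
  | 0 => ⟨fun _ => 1, fun _ => 0, fun _ => Or.inl rfl, fun k x => by simp⟩
  | m + 1 => by
      obtain ⟨E, C, hE, hm⟩ := affineSymmetry_iterate hε hrel m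
      refine ⟨fun k => ε ((π ^ m) k) * E k, fun k => h * C k + c ((π ^ m) k), fun k => ?_, fun k x => ?_⟩
      · rcases hε ((π ^ m) k) with e | e <;> rcases hE k with e' | e' <;> simp [e, e']
      · show a ((π ^ (m + 1)) k) (h ^ (m + 1) * x + (h * C k + c ((π ^ m) k))) = ε ((π ^ m) k) * E k * a k x
        have e : h ^ (m + 1) * x + (h * C k + c ((π ^ m) k)) = h * (h ^ m * x + C k) + c ((π ^ m) k) := by ring
        rw [show (π ^ (m + 1)) k = π ((π ^ m) k) by rw [pow_succ', Equiv.Perm.mul_apply], e, hrel, hm, mul_assoc]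

/-- **every row is invariant under its own affine map `x ↦ h⁴⁸ x + D_k`** (apply the iterate at `m = 24 = |S₄|` twice: the
permutation and the signs square away). -/
theorem blockAffineInvariant_of_affineSymmetry (hε : ∀ k, ε k = 1 ∨ ε k = -1)
    (hrel : ∀ k x, a (π k) (h * x + c k) = ε k * a k x) :
    ∃ D : Fin 4 → ZMod n, ∀ k x, a k (h ^ 48 * x + D k) = a k x := by
  obtain ⟨E, C, hE, h24⟩ := affineSymmetry_iterate hε hrel 24
  have hπ : π ^ 24 = 1 := by
    have h1 : π ^ Fintype.card (Equiv.Perm (Fin 4)) = 1 := pow_card_eq_one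
    rwa [Fintype.card_perm, Fintype.card_fin, show Nat.factorial 4 = 24 by rfl] at h1
  rw [hπ] at h24
  refine ⟨fun k => h ^ 24 * C k + C k, fun k x => ?_⟩
  have e1 := h24 k (h ^ 24 * x + C k)
  have e2 := h24 k x
  simp only [Equiv.Perm.coe_one, id_eq] at e1 e2
  have e : h ^ 48 * x + (h ^ 24 * C k + C k) = h ^ 24 * (h ^ 24 * x + C k) + C k := by ring
  rw [e, e1, e2, ← mul_assoc]
  rcases hE k with s | s <;> simp [s]

end Iterate

/-! ## §2 Rows of a Goethals–Seidel quadruple over `ZMod 167`: never constant, never periodic -/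

/-- `GSQuad` for a `Fin 4`-indexed family of rows, unpacked symmetrically. -/
lemma gsQuad_fin4_iff (a : Fin 4 → ZMod 167 → ℤ) :
    GSQuad (a 0) (a 1) (a 2) (a 3) ↔ (∀ k, IsPM (a k)) ∧ ∀ s : ZMod 167, s ≠ 0 → ∑ k, PAF (a k) s = 0 := by
  constructor
  · rintro ⟨h0, h1, h2, h3, hs⟩
    refine ⟨fun k => ?_, fun s hs0 => ?_⟩
    · fin_cases k
      · exact h0
      · exact h1
      · exact h2
      · exact h3
    · rw [Fin.sum_univ_four]; linarith [hs s hs0]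
  · rintro ⟨hpm, hs⟩
    refine ⟨hpm 0, hpm 1, hpm 2, hpm 3, fun s hs0 => ?_⟩
    have e := hs s hs0
    rw [Fin.sum_univ_four] at e
    linarith

/-- the grammar, symmetric form: `Σ_k (Σ_x a_k(x))² = 668`. -/
lemma gsQuad167_sum_rowsum_sq {a : Fin 4 → ZMod 167 → ℤ} (hq : GSQuad (a 0) (a 1) (a 2) (a 3)) :
    ∑ k, (∑ x, a k x) ^ 2 = 668 := by
  rw [Fin.sum_univ_four]
  exact (gs167_rowsums _ _ _ _ hq).1

/-- **no row of a GS quadruple over `ZMod 167` is constant**: its squared row sum would be `167² > 668`. -/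
theorem gsQuad167_not_constant {a : Fin 4 → ZMod 167 → ℤ} (hq : GSQuad (a 0) (a 1) (a 2) (a 3)) (k : Fin 4)
    (hconst : ∀ x, a k x = a k 0) : False := by
  have hsum := gsQuad167_sum_rowsum_sq hq
  have hpm : IsPM (a k) := ((gsQuad_fin4_iff a).mp hq).1 k
  have hs : ∑ x, a k x = 167 * a k 0 := by
    rw [Finset.sum_congr rfl fun x _ => hconst x, Finset.sum_const, Finset.card_univ, ZMod.card, nsmul_eq_mul]
    norm_num
  have hle : (∑ x, a k x) ^ 2 ≤ ∑ j, (∑ x, a j x) ^ 2 :=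
    Finset.single_le_sum (f := fun j => (∑ x, a j x) ^ 2) (fun j _ => sq_nonneg _) (Finset.mem_univ k)
  rw [hsum, hs] at hle
  rcases hpm 0 with e | e <;> rw [e] at hle <;> norm_num at hle

/-- a function on `ZMod 167` invariant under a non-zero translation is constant (`167` is prime: `d` generates). -/
lemma const_of_translationInvariant_167 {f : ZMod 167 → ℤ} {d : ZMod 167} (hd : d ≠ 0) (hf : ∀ x, f (x + d) = f x)
    (x : ZMod 167) : f x = f 0 := by
  haveI : Fact (Nat.Prime 167) := ⟨by norm_num⟩
  have hj : ∀ j : ℕ, f ((j : ZMod 167) * d) = f 0 := by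
    intro j
    induction j with
    | zero => simp
    | succ j ih => rw [Nat.cast_succ, add_mul, one_mul, hf, ih]
  have hx : x = (((x * d⁻¹ : ZMod 167)).val : ZMod 167) * d := by
    rw [ZMod.natCast_zmod_val, mul_assoc, inv_mul_cancel₀ hd, mul_one]
  rw [hx]
  exact hj _

/-- **no row of a GS quadruple over `ZMod 167` is invariant under a non-zero translation.** -/
theorem gsQuad167_no_translationInvariant_row {a : Fin 4 → ZMod 167 → ℤ} (hq : GSQuad (a 0) (a 1) (a 2) (a 3))
    (k : Fin 4) {d : ZMod 167} (hd : d ≠ 0) (hinv : ∀ x, a k (x + d) = a k x) : False :=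
  gsQuad167_not_constant hq k (const_of_translationInvariant_167 hd hinv)

/-- translating the four rows INDEPENDENTLY preserves `GSQuad` (PAF is translation invariant). -/
lemma gsQuad_translate {n : ℕ} [NeZero n] {a b c d : ZMod n → ℤ} (hq : GSQuad a b c d) (α β γ δ : ZMod n) :
    GSQuad (cycTranslate a α) (cycTranslate b β) (cycTranslate c γ) (cycTranslate d δ) := by
  obtain ⟨ha, hb, hc, hd, hs⟩ := hq
  refine ⟨fun i => ha _, fun i => hb _, fun i => hc _, fun i => hd _, fun s hs0 => ?_⟩
  rw [PAF_translate, PAF_translate, PAF_translate, PAF_translate]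
  exact hs s hs0

/-! ## §3 The exclusion: the multiplier part of a signed/permuted affine symmetry is `±1` -/

/-- `48 ≠ 0` in `ZMod 167`. -/
lemma fortyEight_ne_zero_zmod167 : (48 : ZMod 167) ≠ 0 := by decide

/-- an affine-invariant row `f (g x + D) = f x` with `g` a unit is twisted-`g`-invariant in the tree's sense. -/
lemma twistedInvariant_of_affineInvariant {f : ZMod 167 → ℤ} (u : (ZMod 167)ˣ) {D : ZMod 167}
    (hinv : ∀ x, f ((u : ZMod 167) * x + D) = f x) : TwistedInvariant f u := by
  refine ⟨-(D * ((u⁻¹ : (ZMod 167)ˣ) : ZMod 167)), fun i => ?_⟩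
  have e : (u : ZMod 167) * (i + -(D * ((u⁻¹ : (ZMod 167)ˣ) : ZMod 167))) + D = (u : ZMod 167) * i := by
    have hu : (u : ZMod 167) * ((u⁻¹ : (ZMod 167)ˣ) : ZMod 167) = 1 := Units.mul_inv u
    linear_combination (-D) * hu
  rw [← hinv (i + -(D * ((u⁻¹ : (ZMod 167)ˣ) : ZMod 167))), e]

/-- **EXCLUSION.**  Let `a_0,…,a_3` be the rows of a Goethals–Seidel quadruple over `ZMod 167` and suppose
`a_{π k}(h x + c_k) = ε_k a_k(x)` for all `k, x` (`π ∈ S₄`, `ε_k = ±1`, row-wise shifts `c_k`, any `h ∈ ZMod 167`).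
Then `h² = 1`: the multiplier part of every signed/permuted affine symmetry is `±1`. -/
theorem gsQuad167_affineSymmetry_sq_eq_one {a : Fin 4 → ZMod 167 → ℤ} (hq : GSQuad (a 0) (a 1) (a 2) (a 3))
    {h : ZMod 167} {c : Fin 4 → ZMod 167} {π : Equiv.Perm (Fin 4)} {ε : Fin 4 → ℤ} (hε : ∀ k, ε k = 1 ∨ ε k = -1)
    (hrel : ∀ k x, a (π k) (h * x + c k) = ε k * a k x) : h ^ 2 = 1 := by
  haveI : Fact (Nat.Prime 167) := ⟨by norm_num⟩
  by_contra hsq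
  obtain ⟨D, hD⟩ := blockAffineInvariant_of_affineSymmetry hε hrel
  by_cases h0 : h = 0
  · -- `h = 0`: every row is constant
    subst h0
    refine gsQuad167_not_constant hq 0 fun x => ?_
    have e1 := hD 0 x
    have e2 := hD 0 0
    rw [zero_pow (by norm_num), zero_mul, zero_add] at e1 e2
    rw [← e1, e2]
  · -- `h ≠ 0`, `h² ≠ 1`: `g = h⁴⁸` has `g² ≠ 1`
    set g : ZMod 167 := h ^ 48 with hg
    have hF : h ^ 166 = 1 := by simpa using ZMod.pow_card_sub_one_eq_one h0
    have hg2 : g ^ 2 ≠ 1 := by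
      intro h96
      rw [hg, ← pow_mul, show 48 * 2 = 96 by norm_num] at h96
      have h2 : h ^ Nat.gcd 96 166 = 1 := pow_gcd_eq_one.2 ⟨h96, hF⟩
      rw [show Nat.gcd 96 166 = 2 by decide] at h2
      exact hsq h2
    have hg0 : g ≠ 0 := by rw [hg]; exact pow_ne_zero _ h0
    set u : (ZMod 167)ˣ := Units.mk0 g hg0 with hu
    have hug : (u : ZMod 167) = g := rfl
    have hu1 : (u : ZMod 167) ≠ 1 := by
      intro h1; apply hg2; rw [← hug, h1, one_pow]
    have husq : (u : ZMod 167) ^ 2 ≠ 1 := by rwa [hug]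
    -- each row has a `g`-invariant translate, hence a square-invariant translate
    have hrow : ∀ k, ∃ δ : ZMod 167, ∀ i, cycTranslate (a k) δ (4 * i) = cycTranslate (a k) δ i := by
      intro k
      have htw : TwistedInvariant (a k) u := twistedInvariant_of_affineInvariant u (fun x => by rw [hug]; exact hD k x)
      obtain ⟨δ, hδ⟩ := exists_translate_hInvariant_prime (a k) u hu1 htw
      exact ⟨δ, inv4_of_hInvariant _ u husq hδ⟩
    choose δ hδ using hrow
    have hq' := gsQuad_translate hq (δ 0) (δ 1) (δ 2) (δ 3)
    exact no_gs_quad_qr167 _ _ _ _ hq'.1 hq'.2.1 hq'.2.2.1 hq'.2.2.2.1 (hδ 0) (hδ 1) (hδ 2) (hδ 3) hq'.2.2.2.2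

/-- equivalently: **the multiplier part is `1` or `-1`**. -/
theorem gsQuad167_affineSymmetry_eq_one_or_eq_neg_one {a : Fin 4 → ZMod 167 → ℤ} (hq : GSQuad (a 0) (a 1) (a 2) (a 3))
    {h : ZMod 167} {c : Fin 4 → ZMod 167} {π : Equiv.Perm (Fin 4)} {ε : Fin 4 → ℤ} (hε : ∀ k, ε k = 1 ∨ ε k = -1)
    (hrel : ∀ k x, a (π k) (h * x + c k) = ε k * a k x) : h = 1 ∨ h = -1 := by
  haveI : Fact (Nat.Prime 167) := ⟨by norm_num⟩
  exact mul_self_eq_one_iff.mp (by rw [← sq]; exact gsQuad167_affineSymmetry_sq_eq_one hq hε hrel)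

/-- in particular **no signed/permuted MULTIPLIER of order `83` or `166`** (`h ∉ {0, 1, -1}`, shifts allowed): the census row
'four circulants over `ZMod 167` with a multiplier symmetry of order `> 2`' is EMPTY even when the multiplier permutes and negates
the rows. -/
theorem gsQuad167_no_signedMultiplier {h : ZMod 167} (h1 : h ≠ 1) (hm1 : h ≠ -1) (c : Fin 4 → ZMod 167)
    (π : Equiv.Perm (Fin 4)) (ε : Fin 4 → ℤ) (hε : ∀ k, ε k = 1 ∨ ε k = -1) :
    ¬ ∃ a : Fin 4 → ZMod 167 → ℤ, GSQuad (a 0) (a 1) (a 2) (a 3) ∧ ∀ k x, a (π k) (h * x + c k) = ε k * a k x :=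
  fun ⟨_, hq, hrel⟩ => by
    rcases gsQuad167_affineSymmetry_eq_one_or_eq_neg_one hq hε hrel with e | e
    · exact h1 e
    · exact hm1 e

/-- **negative line: no signed/permuted affine symmetry with `h² ≠ 1`** — this covers `h = 0` and every `h` of multiplicative
order `83` or `166`, with arbitrary row permutation, signs and row-wise translations. -/
theorem gsQuad167_no_affineSymmetry {h : ZMod 167} (hsq : h ^ 2 ≠ 1) (c : Fin 4 → ZMod 167) (π : Equiv.Perm (Fin 4))
    (ε : Fin 4 → ℤ) (hε : ∀ k, ε k = 1 ∨ ε k = -1) :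
    ¬ ∃ a : Fin 4 → ZMod 167 → ℤ, GSQuad (a 0) (a 1) (a 2) (a 3) ∧ ∀ k x, a (π k) (h * x + c k) = ε k * a k x :=
  fun ⟨_, hq, hrel⟩ => hsq (gsQuad167_affineSymmetry_sq_eq_one hq hε hrel)

/-- the unpacked four-row form of the exclusion (rows `a, b, c, d`; the symmetry maps row `k` to row `π k`). -/
theorem no_gs_quad_affineSymmetry167 (a b c d : ZMod 167 → ℤ) (hq : GSQuad a b c d) {h : ZMod 167} (hsq : h ^ 2 ≠ 1)
    (sh : Fin 4 → ZMod 167) (π : Equiv.Perm (Fin 4)) (ε : Fin 4 → ℤ) (hε : ∀ k, ε k = 1 ∨ ε k = -1)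
    (hrel : ∀ k x, (![a, b, c, d] (π k)) (h * x + sh k) = ε k * (![a, b, c, d] k) x) : False :=
  hsq (gsQuad167_affineSymmetry_sq_eq_one (a := ![a, b, c, d]) hq hε hrel)

/-! ## §4 `h = 1`: a common non-zero translation is impossible -/

/-- with a COMMON shift `c` and `h = 1` the iterate has the explicit shift `m • c`. -/
lemma translationSymmetry_iterate {a : Fin 4 → ZMod 167 → ℤ} {c : ZMod 167} {π : Equiv.Perm (Fin 4)} {ε : Fin 4 → ℤ}
    (hε : ∀ k, ε k = 1 ∨ ε k = -1) (hrel : ∀ k x, a (π k) (x + c) = ε k * a k x) :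
    ∀ m : ℕ, ∃ E : Fin 4 → ℤ, (∀ k, E k = 1 ∨ E k = -1) ∧ ∀ k x, a ((π ^ m) k) (x + (m : ZMod 167) * c) = E k * a k x
  | 0 => ⟨fun _ => 1, fun _ => Or.inl rfl, fun k x => by simp⟩
  | m + 1 => by
      obtain ⟨E, hE, hm⟩ := translationSymmetry_iterate hε hrel m
      refine ⟨fun k => ε ((π ^ m) k) * E k, fun k => ?_, fun k x => ?_⟩
      · rcases hε ((π ^ m) k) with e | e <;> rcases hE k with e' | e' <;> simp [e, e']
      · show a ((π ^ (m + 1)) k) (x + ((m + 1 : ℕ) : ZMod 167) * c) = ε ((π ^ m) k) * E k * a k x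
        have e : x + ((m + 1 : ℕ) : ZMod 167) * c = (x + (m : ZMod 167) * c) + c := by push_cast; ring
        rw [show (π ^ (m + 1)) k = π ((π ^ m) k) by rw [pow_succ', Equiv.Perm.mul_apply], e, hrel, hm, mul_assoc]

/-- **no common translation symmetry**: rows of a GS quadruple over `ZMod 167` cannot satisfy `a_{π k}(x + c) = ε_k a_k(x)`
with `c ≠ 0` (every row would have the period `48 c ≠ 0`). -/
theorem gsQuad167_no_commonTranslation {c : ZMod 167} (hc : c ≠ 0) (π : Equiv.Perm (Fin 4)) (ε : Fin 4 → ℤ)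
    (hε : ∀ k, ε k = 1 ∨ ε k = -1) :
    ¬ ∃ a : Fin 4 → ZMod 167 → ℤ, GSQuad (a 0) (a 1) (a 2) (a 3) ∧ ∀ k x, a (π k) (x + c) = ε k * a k x := by
  rintro ⟨a, hq, hrel⟩
  haveI : Fact (Nat.Prime 167) := ⟨by norm_num⟩
  obtain ⟨E, hE, h24⟩ := translationSymmetry_iterate hε hrel 24
  have hπ : π ^ 24 = 1 := by
    have h1 : π ^ Fintype.card (Equiv.Perm (Fin 4)) = 1 := pow_card_eq_one
    rwa [Fintype.card_perm, Fintype.card_fin, show Nat.factorial 4 = 24 by rfl] at h1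
  rw [hπ] at h24
  have hd : (48 : ZMod 167) * c ≠ 0 := mul_ne_zero fortyEight_ne_zero_zmod167 hc
  refine gsQuad167_no_translationInvariant_row hq 0 hd fun x => ?_
  have e1 := h24 0 (x + ((24 : ℕ) : ZMod 167) * c)
  have e2 := h24 0 x
  simp only [Equiv.Perm.coe_one, id_eq] at e1 e2
  have e : x + 48 * c = x + ((24 : ℕ) : ZMod 167) * c + ((24 : ℕ) : ZMod 167) * c := by push_cast; ring
  rw [e, e1, e2, ← mul_assoc]
  rcases hE 0 with s | s <;> simp [s]

/-! ## §5 `h = -1`: reflections are recentred reversal symmetries (the Williamson shape, OPEN) -/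

/-- `2 · 84 = 1` in `ZMod 167`. -/
lemma two_mul_84_zmod167 : (2 : ZMod 167) * 84 = 1 := by decide

/-- **reflections recentre to reversals.**  A signed/permuted reflection symmetry `a_{π k}(c - x) = ε_k a_k(x)` with a common
centre becomes, after translating every row by `84 c` (half of `c`), a signed/permuted REVERSAL symmetry
`a'_{π k}(-x) = ε_k a'_k(x)` of a GS quadruple — the structured shape that contains the Williamson quadruples (`π = 1`, `ε = 1`).
No exclusion is claimed for it. -/
theorem gsQuad167_reflection_recentre {a : Fin 4 → ZMod 167 → ℤ} (hq : GSQuad (a 0) (a 1) (a 2) (a 3)) {c : ZMod 167}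
    {π : Equiv.Perm (Fin 4)} {ε : Fin 4 → ℤ} (hrel : ∀ k x, a (π k) (-x + c) = ε k * a k x) :
    GSQuad (cycTranslate (a 0) (84 * c)) (cycTranslate (a 1) (84 * c)) (cycTranslate (a 2) (84 * c)) (cycTranslate (a 3) (84 * c)) ∧
      ∀ k x, cycTranslate (a (π k)) (84 * c) (-x) = ε k * cycTranslate (a k) (84 * c) x := by
  refine ⟨gsQuad_translate hq _ _ _ _, fun k x => ?_⟩
  unfold Literature.Combinatorics.Designs.LegendrePairs.translate
  have e : -x + 84 * c = -(x + 84 * c) + c := by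
    linear_combination c * two_mul_84_zmod167
  rw [e]
  exact hrel k (x + 84 * c)

/-- **summary (gen 26).**  For rows of a Goethals–Seidel quadruple over `ZMod 167` and a signed/permuted affine symmetry
`a_{π k}(h x + c_k) = ε_k a_k(x)`: (i) `h² = 1`; (ii) if moreover the shifts are a common `c` and `h = 1` then `c = 0`.
lottery ticket; floor = certified bounds/negative ranges. -/
theorem gsQuad167_affineSymmetry_census {a : Fin 4 → ZMod 167 → ℤ} (hq : GSQuad (a 0) (a 1) (a 2) (a 3))
    {h : ZMod 167} {c : Fin 4 → ZMod 167} {π : Equiv.Perm (Fin 4)} {ε : Fin 4 → ℤ} (hε : ∀ k, ε k = 1 ∨ ε k = -1)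
    (hrel : ∀ k x, a (π k) (h * x + c k) = ε k * a k x) :
    h ^ 2 = 1 ∧ (h = 1 → (∀ k, c k = c 0) → ∀ k, c k = 0) := by
  refine ⟨gsQuad167_affineSymmetry_sq_eq_one hq hε hrel, fun h1 hcommon k => ?_⟩
  rw [hcommon k]
  by_contra hc
  subst h1
  refine gsQuad167_no_commonTranslation hc π ε hε ⟨a, hq, fun k x => ?_⟩
  rw [← hrel k x, one_mul, hcommon k]

end Summit.Ventures.DiscreteObjects.Hadamard
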